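import Summits.MatrixMultiplication.MatrixMultiplication.Theorems.SoloInformedTwistedMatchingsJennings
import HarnessLib

/-!
# Twisted matchings, weighted levels: the `p`-central filtration is stable under endomorphisms
# that respect the levels

Solo-informed seat (MatrixMultiplication), gen 101; sequel of
`SoloInformedTwistedMatchingsJennings.lean` (one level, `S` elementary abelian). Here the
`p`-central generating system `C` of `S` may have any number of levels (weights
`W_a = (p+1)^{lvl a}`); the filtration `M_d` of `K[S]` is stable under the push-forward along a
group endomorphism `φ` as soon as `φ(gen a) - 1 ∈ M_{W_a}` for every generator — which holds
whenever `φ(gen a)` lies in the subgroup generated by the generators of level `≥ lvl a`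
(`pcgs_of_sub_one_mem_M_of_mem_closure`). For abelian `p`-groups with the generating system
`(p^s e_i)` this is automatic for EVERY endomorphism (next file), giving the bounded-exponent form
of the seat's Theorem B″ (sharpest-statement §2y(8)).

* `pcgs_of_mul_sub_one_mem_M`, `pcgs_of_pow_sub_one_mem_M`, `pcgs_of_sub_one_mem_M_of_mem_closure`
  — `{h : h - 1 ∈ M_d}` is a subgroup; `pcgs_of_gen_sub_one_mem_M` — it contains the generators of
  weight `≥ d`.
* `pcgs_mapDomain_mem_M_of_gen` — level-respecting endomorphisms preserve every `M_d`;
  `pcgs_pushforward_filtered_of_gen` — hence their push-forwards are filtered for the graded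
  coordinates `C.gradedCoords`; `card_le_of_levelTwistedMatching` — the twisted codimension bound
  for automorphism twists in any finite `p`-group all of whose endomorphisms respect the levels.

References: BlasiakChurchCohnGrochowUmans2017 (arXiv:1712.02302) Def. 3.5, Prop. 3.10;
CohnUmans2013 (arXiv:1207.6528) §5, Conj. 21; S. A. Jennings, Trans. AMS 50 (1941).
-/

noncomputable section

open scoped BigOperators
open Finset Literature.Combinatorics.Additive Literature.Barriers.MatrixMultiplication

namespace Summit.MatrixMultiplication.MatrixMultiplication.Theorems.TwistedSliceRank

universe u' v' w'

section Weighted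

variable {p : ℕ} {S : Type u'} [Group S] {ι : Type w'} [LinearOrder ι] [Fintype ι]
  (C : PCGS p S ι) {K : Type v'} [Field K]

/-- `hk - 1 = (h - 1)(k - 1) + (h - 1) + (k - 1)` in `K[S]`. [folklore] -/
theorem of_mul_sub_one (h k : S) :
    MonoidAlgebra.of K S (h * k) - 1 = (MonoidAlgebra.of K S h - 1) * (MonoidAlgebra.of K S k - 1) +
      (MonoidAlgebra.of K S h - 1) + (MonoidAlgebra.of K S k - 1) := by
  rw [map_mul]; noncomm_ring

variable [Fact p.Prime] [CharP K p]

/-- `{h ∈ S : h - 1 ∈ M_d}` is closed under multiplication. [folklore] -/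
theorem pcgs_of_mul_sub_one_mem_M {d : ℕ} {h k : S} (hh : MonoidAlgebra.of K S h - 1 ∈ C.M K d)
    (hk : MonoidAlgebra.of K S k - 1 ∈ C.M K d) : MonoidAlgebra.of K S (h * k) - 1 ∈ C.M K d := by
  rw [of_mul_sub_one]
  refine Submodule.add_mem _ (Submodule.add_mem _ ?_ hh) hk
  exact C.M_anti (Nat.le_add_right d d) (C.M_mul_M_le d d (Submodule.mul_mem_mul hh hk))

/-- `{h ∈ S : h - 1 ∈ M_d}` is closed under powers. [folklore] -/
theorem pcgs_of_pow_sub_one_mem_M {d : ℕ} {h : S} (hh : MonoidAlgebra.of K S h - 1 ∈ C.M K d)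
    (m : ℕ) : MonoidAlgebra.of K S (h ^ m) - 1 ∈ C.M K d := by
  induction m with
  | zero => rw [pow_zero, map_one, sub_self]; exact Submodule.zero_mem _
  | succ m ih => rw [pow_succ]; exact pcgs_of_mul_sub_one_mem_M C ih hh

/-- `{h ∈ S : h - 1 ∈ M_d}` contains the subgroup generated by any subset of it (`S` finite).
[folklore] -/
theorem pcgs_of_sub_one_mem_M_of_mem_closure [Finite S] {d : ℕ} {T : Set S}
    (hT : ∀ h ∈ T, MonoidAlgebra.of K S h - 1 ∈ C.M K d) {g : S} (hg : g ∈ Subgroup.closure T) :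
    MonoidAlgebra.of K S g - 1 ∈ C.M K d := by
  induction hg using Subgroup.closure_induction with
  | mem h hh => exact hT h hh
  | one => rw [map_one, sub_self]; exact Submodule.zero_mem _
  | mul h k _ _ hh hk => exact pcgs_of_mul_sub_one_mem_M C hh hk
  | inv h _ hh =>
    have hfin : IsOfFinOrder h := isOfFinOrder_of_finite h
    have : h⁻¹ = h ^ (orderOf h - 1) := by
      rw [eq_comm, ← mul_eq_one_iff_eq_inv, ← pow_succ,
        Nat.sub_add_cancel hfin.orderOf_pos, pow_orderOf_eq_one]
    rw [this]
    exact pcgs_of_pow_sub_one_mem_M C hh _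

/-- A generator of weight `≥ d` satisfies `gen(b) - 1 ∈ M_d`. [folklore] -/
theorem pcgs_of_gen_sub_one_mem_M {d : ℕ} {b : ι} (hb : d ≤ C.W b) :
    MonoidAlgebra.of K S (C.gen b) - 1 ∈ C.M K d := by
  have h : C.eval K [b] ∈ C.M K (C.wt [b]) := C.eval_mem_M _
  rw [PCGS.eval_singleton, PCGS.wt_cons, PCGS.wt_nil, add_zero] at h
  exact C.M_anti hb h

/-- If `φ(gen a)` lies in the subgroup generated by the generators of level `≥ lvl a`, then
`φ(gen a) - 1 ∈ M_{W_a}` (`S` finite). [folklore] -/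
theorem pcgs_of_sub_one_mem_M_W [Finite S] (a : ι) {g : S}
    (hg : g ∈ Subgroup.closure (C.gen '' {b | C.lvl a ≤ C.lvl b})) :
    MonoidAlgebra.of K S g - 1 ∈ C.M K (C.W a) := by
  refine pcgs_of_sub_one_mem_M_of_mem_closure C ?_ hg
  rintro _ ⟨b, hb, rfl⟩
  exact pcgs_of_gen_sub_one_mem_M C (Nat.pow_le_pow_right (Nat.succ_pos p) hb)

/-- A product `∏_{a ∈ w} f(a)` with `f(a) ∈ M_{W_a}` lies in `M_{wt w}`. [folklore] -/
theorem pcgs_list_prod_mem_M_wt (f : ι → MonoidAlgebra K S) (hf : ∀ a, f a ∈ C.M K (C.W a))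
    (w : List ι) : (w.map f).prod ∈ C.M K (C.wt w) := by
  induction w with
  | nil => rw [List.map_nil, List.prod_nil, PCGS.wt_nil, C.M_zero_eq_top]; exact Submodule.mem_top
  | cons a w ih =>
    rw [List.map_cons, List.prod_cons, PCGS.wt_cons]
    exact C.M_mul_M_le (C.W a) (C.wt w) (Submodule.mul_mem_mul (hf a) ih)

/-- The push-forward of a word along an endomorphism `φ` with `φ(gen a) - 1 ∈ M_{W_a}` for all `a`
lies in `M_{wt w}`. [folklore] -/
theorem pcgs_mapDomain_eval_mem_M_wt (φ : S →* S)
    (hφ : ∀ a, MonoidAlgebra.of K S (φ (C.gen a)) - 1 ∈ C.M K (C.W a)) (w : List ι) :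
    MonoidAlgebra.mapDomainAlgHom K K φ (C.eval K w) ∈ C.M K (C.wt w) := by
  unfold PCGS.eval
  rw [map_list_prod, List.map_map]
  have h := pcgs_list_prod_mem_M_wt C (⇑(MonoidAlgebra.mapDomainAlgHom K K φ) ∘ C.u K) ?_ w
  · exact h
  · intro a
    have hof : MonoidAlgebra.mapDomainAlgHom K K φ (MonoidAlgebra.of K S (C.gen a)) =
        MonoidAlgebra.of K S (φ (C.gen a)) := by
      simp [MonoidAlgebra.of_apply, MonoidAlgebra.mapDomain_single]
    simp only [Function.comp_apply, PCGS.u, map_sub, map_one, hof]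
    exact hφ a

/-- **Level-respecting endomorphisms preserve the filtration**: if `φ(gen a) - 1 ∈ M_{W_a}` for
every generator then `φ_*(M_d) ⊆ M_d` for every `d`. [folklore] -/
theorem pcgs_mapDomain_mem_M_of_gen (φ : S →* S)
    (hφ : ∀ a, MonoidAlgebra.of K S (φ (C.gen a)) - 1 ∈ C.M K (C.W a)) {d : ℕ}
    {f : MonoidAlgebra K S} (hf : f ∈ C.M K d) :
    MonoidAlgebra.mapDomainAlgHom K K φ f ∈ C.M K d := by
  unfold PCGS.M at hf
  induction hf using Submodule.span_induction with
  | mem y hy =>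
    obtain ⟨w, ⟨-, hw⟩, rfl⟩ := hy
    exact C.M_anti hw (pcgs_mapDomain_eval_mem_M_wt C φ hφ w)
  | zero => simp
  | add y z _ _ hy hz => rw [map_add]; exact Submodule.add_mem _ hy hz
  | smul r y _ hy => rw [map_smul]; exact Submodule.smul_mem _ r hy

variable [Fintype S] [DecidableEq S]

/-- **Filteredness of level-respecting endomorphism twists**: for `deg j < deg j'` the
`β_j`-coordinate of `φ_*(β_{j'})` vanishes. [folklore] -/
theorem pcgs_pushforward_filtered_of_gen (φ : S →* S)
    (hφ : ∀ a, MonoidAlgebra.of K S (φ (C.gen a)) - 1 ∈ C.M K (C.W a)) (j' j : ι → Fin p)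
    (h : C.deg j < C.deg j') :
    ∑ x', (C.gradedCoords K).P j' x' * (C.gradedCoords K).Q (φ x') j = 0 := by
  classical
  have hP : ∀ x', (C.gradedCoords K).P j' x' = ((C.basis K) j').coeff x' := fun _ => rfl
  have hQ : ∀ y, (C.gradedCoords K).Q y j = (C.basis K).repr (MonoidAlgebra.of K S y) j :=
    fun _ => rfl
  simp_rw [hP, hQ]
  have hexp : ∀ f : MonoidAlgebra K S, f = ∑ x, f.coeff x • MonoidAlgebra.of K S x := fun f => by
    apply MonoidAlgebra.coeff_injective
    rw [MonoidAlgebra.coeff_sum]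
    conv_lhs => rw [← Finsupp.univ_sum_single f.coeff]
    refine Finset.sum_congr rfl fun x _ => ?_
    rw [MonoidAlgebra.coeff_smul, MonoidAlgebra.of_apply, MonoidAlgebra.coeff_single,
      Finsupp.smul_single_one]
  have hΦ : MonoidAlgebra.mapDomainAlgHom K K φ ((C.basis K) j') =
      ∑ x, ((C.basis K) j').coeff x • MonoidAlgebra.of K S (φ x) := by
    conv_lhs => rw [hexp ((C.basis K) j')]
    rw [map_sum]
    refine Finset.sum_congr rfl fun x _ => ?_
    rw [map_smul]
    congr 1
    simp [MonoidAlgebra.of_apply, MonoidAlgebra.mapDomain_single]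
  have hcoord : (C.basis K).repr (MonoidAlgebra.mapDomainAlgHom K K φ ((C.basis K) j')) j =
      ∑ x, ((C.basis K) j').coeff x * (C.basis K).repr (MonoidAlgebra.of K S (φ x)) j := by
    rw [hΦ, map_sum, Finsupp.coe_finsetSum, Finset.sum_apply]
    refine Finset.sum_congr rfl fun x _ => ?_
    rw [map_smul, Finsupp.smul_apply, smul_eq_mul]
  rw [← hcoord]
  have hmem : MonoidAlgebra.mapDomainAlgHom K K φ ((C.basis K) j') ∈ C.M K (C.deg j') := by
    refine pcgs_mapDomain_mem_M_of_gen C φ hφ ?_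
    rw [PCGS.coe_basis]
    show C.eval K (canonWord fun a => ((j' a : Fin p) : ℕ)) ∈ C.M K (C.deg j')
    refine C.M_anti (le_of_eq (C.wt_canon_expo j').symm) (C.eval_mem_M _)
  have hsub := (C.basis K).repr_support_subset_of_mem_span _ (pcgs_M_le_span_basis C _ hmem)
  by_contra hne
  have hj := hsub (Finsupp.mem_support_iff.2 hne)
  simp only [Set.mem_setOf_eq] at hj
  omega

/-- **Twisted codimension bound for level-respecting automorphism twists**: if EVERY endomorphism
of the finite `p`-group `S` maps each generator into the subgroup generated by the generators of
at least its level (e.g. `S` abelian with the generating system `(p^s e_i)`), then for weights `t`,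
automorphism twists `(φ_s, ψ_s)` and a weighted twisted matching `(x_i, y_i, z_i)_{i ∈ ι'}` one has
`|ι'| ≤ #{deg < a} + #{deg < b} + #{deg ≥ a + b}`. [this work] -/
theorem card_le_of_levelTwistedMatching
    (hS : ∀ (φ : S →* S) (a : ι), φ (C.gen a) ∈ Subgroup.closure (C.gen '' {b | C.lvl a ≤ C.lvl b}))
    {σ : Type*} [Fintype σ] (t : σ → K) (φ ψ : σ → S ≃* S) {ι' : Type*} [Fintype ι']
    (x y z : ι' → S)
    (hoff : ∀ (i j l : ι') (s : σ), x i * φ s (y j) * ψ s (z l) = 1 → i = j ∧ j = l)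
    (hdiag : ∀ i : ι', (∑ s, t s * (if x i * φ s (y i) * ψ s (z i) = 1 then (1 : K) else 0)) ≠ 0)
    (a b : ℕ) :
    Fintype.card ι' ≤ Fintype.card {e : ι → Fin p // C.deg e < a} +
      Fintype.card {e : ι → Fin p // C.deg e < b} +
      Fintype.card {e : ι → Fin p // a + b ≤ C.deg e} := by
  classical
  have hgen : ∀ (φ : S →* S) (a : ι), MonoidAlgebra.of K S (φ (C.gen a)) - 1 ∈ C.M K (C.W a) :=
    fun φ a => pcgs_of_sub_one_mem_M_W C a (hS φ a)
  have h := card_le_of_twistedMatching (C.gradedCoords K) t (fun s g => φ s g) (fun s g => ψ s g)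
    ?_ ?_ x y z hoff hdiag a b
  · convert h using 4 <;> rfl
  · intro s j' j hlt
    have := pcgs_pushforward_filtered_of_gen C (K := K) ((φ s : S ≃* S) : S →* S)
      (hgen _) j' j (by simpa only [PCGS.gradedCoords_deg] using hlt)
    simpa using this
  · intro s k k' hlt
    have h1 : ∀ b : S, (ψ s b⁻¹)⁻¹ = ψ s b := fun b => by rw [map_inv, inv_inv]
    simp_rw [h1]
    have := pcgs_pushforward_filtered_of_gen C (K := K) (((ψ s).symm : S ≃* S) : S →* S)
      (hgen _) k k' (by simpa only [PCGS.gradedCoords_deg] using hlt)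
    rw [show (∑ b, (C.gradedCoords K).P k (ψ s b) * (C.gradedCoords K).Q b k') =
        ∑ x', (C.gradedCoords K).P k x' * (C.gradedCoords K).Q ((ψ s).symm x') k' from
      Fintype.sum_equiv (ψ s).toEquiv _ _ (fun b => by simp)]
    simpa using this

end Weighted

end Summit.MatrixMultiplication.MatrixMultiplication.Theorems.TwistedSliceRank
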